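import Mathlib
import Summits.Ventures.HodgeRepro.Tier4.Common.SettingOfData
import Summits.Ventures.HodgeRepro.Tier4.Common.CompactOpenLevel
import Summits.Ventures.HodgeRepro.Tier4.Common.PlaceCommute
import Summits.Ventures.HodgeRepro.Tier4.Line1.RationalPoints
import Summits.Ventures.HodgeRepro.Tier4.Line1.FiniteLevelIsolation
import Summits.Ventures.HodgeRepro.Tier4.Line4.ProjectedTestList
import Summits.Ventures.HodgeRepro.Tier4.Line4.StabilityOfProjected
import Summits.Ventures.HodgeRepro.Tier4.Line4.ProjectorSupport

/-!
# Tier4/Line4/ProjectedSupport — C-L4-PROJSUPP: the support of the projected pair, and the isolation of its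
geometric support

Blind re-derivation cell `pub-hodge-repro`, Tier 4 «PROVE THE STEP» (README §9–§10), LINE L4, seat t4-L2-p1 g2 on
t4-plan-4 g3's cut C-L4-PROJSUPP (S14260, census §11) — the last step before `J_eq_orbital_of_isolated` on the
projector class.

* (1) is the general-group half, `Tier4/Line4/ProjectorSupport.lean`: `ProjDatum.prodSet` / `prodSetRev` and
  `tsupport_biProjList_subset` (the composite bi-projector of a compactly supported `f` is supported in
  `prodSet l · tsupport f · prodSetRev l`), `tsupport_conv_subset`.
* (2) `archTorus' W = ∏_w T′_w` (the archimedean torus of `T′`, a product of pairwise commuting compact subgroups),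
  `archSat W K = archTorus' W · K`; `isCompact_archSat`, `archTorus'_subset_infinitePart` (every `T′_w` sits in `G_∞`:
  `mem_infinitePart_of_isAtPlace`), `archSat_mul_archSat_subset` (the local tori commute with each other and with every
  `K ≤ G(𝔸_f)`: PlaceCommute).
* (3) `tsupport_projTest_subset`: `tsupport (projTest f) ⊆ archSat W K · tsupport f · archSat W K` — (1) on
  `projData = places.map placeDatum ++ [levelDatum]`, whose forward product IS `archSat` and whose reversed product
  equals it by the pairwise commutation (`prodSetRev_eq_prodSet_of_pairwise`).
* (4) `tsupport_conv_projTest_subset`: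
  `tsupport (conv (projTest f) (projTest f′)) ⊆ archSat · tsupport f · archSat · tsupport f′ · archSat`.
* (5) `geoSupport_subset_singleton_of_tsupport_subset`: a function supported in the isolated double coset
  `(Ω · K(N)) · {γ₀} · (Ω · K(N))` of `exists_level_isolating_doubleCoset_archCompact` (IsolationArchCompactDC p691608) has
  geometric support `⊆ {orbitOf γ₀}` — `geoSupport`, `subset_tsupport`, the isolation hypothesis.

CONSUMER (plan-4, v0.28): `K := levelK W N` with `N` from ISOLPROJ-DC for `Ω := T′_∞ Ω₀ ∪ T′_∞ Ω₀′ T′_∞`; (4) + (5) give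
`geoSupport (conv (projTest f) (projTest f′)) ⊆ {orbitOf γ₀}`, the contrapositive of `orbital_eq_zero_of_not_mem` the
equality of `J_eq_orbital_of_isolated`.  No printed input.  Nothing here says anything about the status of the Hodge
conjecture for CM abelian varieties, which is NOT proved (HC_CM is NOT proved by anyone in this repository).
-/

set_option autoImplicit false

noncomputable section

namespace Summit.Ventures.HodgeRepro.Tier4.Line4

open Summit.Ventures.HodgeRepro.Tier4.Common Summit.Ventures.HodgeRepro.Tier4.Line1 MeasureTheory NumberField
  IsDedekindDomain
open scoped ComplexConjugate Pointwise

/-! ### (2) The archimedean torus of `T′` and the saturation `T′_∞ · K` -/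

section Arch

variable {k : Type} [Field k] [NumberField k] (W : PlaneData k) [MeasurableSpace (GA W)] [BorelSpace (GA W)]

omit [MeasurableSpace (GA W)] [BorelSpace (GA W)] in
/-- An element supported at an infinite place has trivial finite part: `atPlace W w ≤ G_∞`. -/
theorem mem_infinitePart_of_isAtPlace {w : InfinitePlace k} {g : GA W} (hg : IsAtPlace W w g) :
    g ∈ infinitePart W := by
  rw [mem_infinitePart, ← finM_one (k := k)]
  refine Matrix.ext fun i j => ?_
  simp only [finM, Matrix.map_apply]
  refine RestrictedProduct.ext _ _ fun v => ?_
  have h := congrArg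
    (fun u : GL (Fin 4) (v.adicCompletion k) => (u : Matrix (Fin 4) (Fin 4) (v.adicCompletion k)) i j) (hg.1 v)
  rw [GA.finiteComponent_apply] at h
  change adComponentFin k v (GA.mat W g i j) = adComponentFin k v ((1 : M4 k) i j)
  rw [h]
  by_cases hij : i = j
  · subst hij
    simp [Matrix.one_apply_eq]
  · simp [Matrix.one_apply_ne hij]

omit [MeasurableSpace (GA W)] [BorelSpace (GA W)] in
/-- The local torus of `T′` at `w` lies in `G_∞`. -/
theorem localTorusAt'_subset_infinitePart (w : InfinitePlace k) :
    (localTorusAt' W w : Set (GA W)) ⊆ (infinitePart W : Set (GA W)) :=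
  fun _ hg => mem_infinitePart_of_isAtPlace W hg.2

/-- **The archimedean torus of `T′`**: the product `∏_w T′_w` of the local tori over the infinite places
(as an ordered product of sets; the factors commute pairwise). -/
def archTorus' : Set (GA W) :=
  ((Finset.univ : Finset (InfinitePlace k)).toList.map fun w => (localTorusAt' W w : Set (GA W))).prod

/-- **The saturation `T′_∞ · K`** of a level `K`. -/
def archSat (K : Subgroup (GA W)) : Set (GA W) := archTorus' W * (K : Set (GA W))

omit [BorelSpace (GA W)] in
/-- The archimedean torus is the product of the place data of the projector. -/
theorem archTorus'_eq_prodSet (q : QuadData k) (g g' : Matrix (Fin 4) (Fin 4) k) (eP' eM' : InfinitePlace k → ℤ)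
    (ν : ∀ w : InfinitePlace k, Measure (localTorusAt' W w)) :
    archTorus' W = ProjDatum.prodSet ((Finset.univ : Finset (InfinitePlace k)).toList.map
      (placeDatum W q g g' eP' eM' ν)) := by
  unfold archTorus'
  generalize (Finset.univ : Finset (InfinitePlace k)).toList = l
  induction l with
  | nil => rfl
  | cons w l ih => rw [List.map_cons, List.prod_cons, List.map_cons, ProjDatum.prodSet_cons, ih]; rfl

omit [BorelSpace (GA W)] in
/-- The place data of the projector commute pairwise (a restatement of the first half of `pairwise_projData`). -/
theorem pairwise_placeData (q : QuadData k) (g g' : Matrix (Fin 4) (Fin 4) k) (eP' eM' : InfinitePlace k → ℤ)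
    (ν : ∀ w : InfinitePlace k, Measure (localTorusAt' W w)) :
    ((Finset.univ : Finset (InfinitePlace k)).toList.map (placeDatum W q g g' eP' eM' ν)).Pairwise
      ProjDatum.Commutes := by
  rw [List.pairwise_map]
  refine (Finset.nodup_toList _).imp ?_
  intro w w' hww' a ha b hb
  exact localTorusAt'_commute_of_ne W hww' a ha b hb

omit [MeasurableSpace (GA W)] [BorelSpace (GA W)] in
/-- `T′_∞` is compact when every local torus is. -/
theorem isCompact_archTorus' (hcompT : ∀ w, IsCompact (localTorusAt' W w : Set (GA W))) :
    IsCompact (archTorus' W) := by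
  unfold archTorus'
  generalize (Finset.univ : Finset (InfinitePlace k)).toList = l
  induction l with
  | nil => exact isCompact_singleton
  | cons w l ih => exact (hcompT w).mul ih

omit [MeasurableSpace (GA W)] [BorelSpace (GA W)] in
/-- **`T′_∞ · K` is compact** for compact local tori and a compact level. -/
theorem isCompact_archSat (hcompT : ∀ w, IsCompact (localTorusAt' W w : Set (GA W))) (K : Subgroup (GA W))
    (hKc : IsCompact (K : Set (GA W))) : IsCompact (archSat W K) :=
  (isCompact_archTorus' W hcompT).mul hKc

omit [MeasurableSpace (GA W)] [BorelSpace (GA W)] in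
/-- **`T′_∞ ⊆ G_∞`**. -/
theorem archTorus'_subset_infinitePart : archTorus' W ⊆ (infinitePart W : Set (GA W)) := by
  unfold archTorus'
  generalize (Finset.univ : Finset (InfinitePlace k)).toList = l
  induction l with
  | nil =>
    rintro x hx
    rw [List.map_nil, List.prod_nil, Set.mem_one] at hx
    rw [hx]
    exact (infinitePart W).one_mem
  | cons w l ih =>
    rw [List.map_cons, List.prod_cons]
    exact (Set.mul_subset_mul (localTorusAt'_subset_infinitePart W w) ih).trans (coe_mul_coe_subset _)

omit [MeasurableSpace (GA W)] [BorelSpace (GA W)] in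
/-- `T′_∞` commutes with every `K ≤ G(𝔸_f)`. -/
theorem archTorus'_mul_comm {K : Subgroup (GA W)} (hK : K ≤ finitePart W) :
    archTorus' W * (K : Set (GA W)) = (K : Set (GA W)) * archTorus' W := by
  refine Set.mul_comm_of_forall fun a ha b hb => ?_
  revert a
  unfold archTorus'
  generalize (Finset.univ : Finset (InfinitePlace k)).toList = l
  induction l with
  | nil =>
    intro a ha
    rw [List.map_nil, List.prod_nil, Set.mem_one] at ha
    rw [ha, one_mul, mul_one]
  | cons w l ih =>
    rintro a ⟨x, hx, y, hy, rfl⟩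
    rw [mul_assoc, ih y hy, ← mul_assoc, localTorusAt'_commute_of_le_finitePart W w hK x hx b hb, mul_assoc]

omit [MeasurableSpace (GA W)] [BorelSpace (GA W)] in
/-- An element of the product of the local tori over a list of places commutes with every element supported at a
place outside the list. -/
theorem torusProd_mul_comm_of_notMem (l : List (InfinitePlace k)) {w : InfinitePlace k} (hw : w ∉ l)
    {b : GA W} (hb : b ∈ localTorusAt' W w) :
    ∀ x ∈ (l.map fun w' => (localTorusAt' W w' : Set (GA W))).prod, x * b = b * x := by
  induction l with
  | nil =>
    intro x hx
    rw [List.map_nil, List.prod_nil, Set.mem_one] at hx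
    rw [hx, one_mul, mul_one]
  | cons w' l ih =>
    rintro x ⟨y, hy, z, hz, rfl⟩
    have hw' : w' ≠ w := fun h => hw (h ▸ List.mem_cons_self ..)
    rw [mul_assoc, ih (fun h => hw (List.mem_cons_of_mem _ h)) z hz, ← mul_assoc,
      localTorusAt'_commute_of_ne W hw' y hy b hb, mul_assoc]

omit [MeasurableSpace (GA W)] [BorelSpace (GA W)] in
/-- The product of the local tori over a duplicate-free list of places absorbs its own products. -/
theorem torusProd_mul_torusProd_subset (l : List (InfinitePlace k)) (hl : l.Nodup) :
    (l.map fun w => (localTorusAt' W w : Set (GA W))).prod * (l.map fun w => (localTorusAt' W w : Set (GA W))).prod ⊆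
      (l.map fun w => (localTorusAt' W w : Set (GA W))).prod := by
  induction l with
  | nil => rw [List.map_nil, List.prod_nil, one_mul]
  | cons w l ih =>
    rw [List.map_cons, List.prod_cons]
    set P : Set (GA W) := (l.map fun w => (localTorusAt' W w : Set (GA W))).prod with hP
    have hcomm : P * (localTorusAt' W w : Set (GA W)) = (localTorusAt' W w : Set (GA W)) * P :=
      Set.mul_comm_of_forall fun x hx b hb =>
        torusProd_mul_comm_of_notMem W l (List.nodup_cons.1 hl).1 hb x hx
    calc (localTorusAt' W w : Set (GA W)) * P * ((localTorusAt' W w : Set (GA W)) * P)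
        = (localTorusAt' W w : Set (GA W)) * (P * (localTorusAt' W w : Set (GA W))) * P := by
          simp only [mul_assoc]
      _ = (localTorusAt' W w : Set (GA W)) * ((localTorusAt' W w : Set (GA W)) * P) * P := by rw [hcomm]
      _ = ((localTorusAt' W w : Set (GA W)) * (localTorusAt' W w : Set (GA W))) * (P * P) := by
          simp only [mul_assoc]
      _ ⊆ (localTorusAt' W w : Set (GA W)) * P :=
          Set.mul_subset_mul (coe_mul_coe_subset _) (ih (List.nodup_cons.1 hl).2)

omit [MeasurableSpace (GA W)] [BorelSpace (GA W)] in
/-- `T′_∞` absorbs its own products (the local tori are pairwise commuting subgroups). -/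
theorem archTorus'_mul_archTorus'_subset : archTorus' W * archTorus' W ⊆ archTorus' W :=
  torusProd_mul_torusProd_subset W _ (Finset.nodup_toList _)

omit [MeasurableSpace (GA W)] [BorelSpace (GA W)] in
/-- **`T′_∞ K` absorbs its own products** for `K ≤ G(𝔸_f)`. -/
theorem archSat_mul_archSat_subset {K : Subgroup (GA W)} (hK : K ≤ finitePart W) :
    archSat W K * archSat W K ⊆ archSat W K := by
  unfold archSat
  calc archTorus' W * (K : Set (GA W)) * (archTorus' W * (K : Set (GA W)))
      = archTorus' W * ((K : Set (GA W)) * archTorus' W) * (K : Set (GA W)) := by simp only [mul_assoc]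
    _ = archTorus' W * (archTorus' W * (K : Set (GA W))) * (K : Set (GA W)) := by rw [archTorus'_mul_comm W hK]
    _ = (archTorus' W * archTorus' W) * ((K : Set (GA W)) * (K : Set (GA W))) := by simp only [mul_assoc]
    _ ⊆ archTorus' W * (K : Set (GA W)) :=
        Set.mul_subset_mul (archTorus'_mul_archTorus'_subset W) (coe_mul_coe_subset K)

end Arch

/-! ### (3)–(5) The projected pair -/

section Projected

variable {k : Type} [Field k] [NumberField k] (W : PlaneData k) [MeasurableSpace (GA W)] [BorelSpace (GA W)]
  (q : QuadData k) (g g' : Matrix (Fin 4) (Fin 4) k) (eP' eM' : InfinitePlace k → ℤ)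
  (ν : ∀ w : InfinitePlace k, Measure (localTorusAt' W w)) (K : Subgroup (GA W)) (νK : Measure K)

omit [BorelSpace (GA W)] in
/-- The forward product of the projector data is `T′_∞ · K`. -/
theorem prodSet_projData : ProjDatum.prodSet (projData W q g g' eP' eM' ν K νK) = archSat W K := by
  unfold projData archSat
  rw [ProjDatum.prodSet_append, ← archTorus'_eq_prodSet W q g g' eP' eM' ν, ProjDatum.prodSet_cons,
    ProjDatum.prodSet_nil, mul_one]
  rfl

omit [BorelSpace (GA W)] in
/-- The reversed product of the projector data is `T′_∞ · K` as well (`K ≤ G(𝔸_f)`). -/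
theorem prodSetRev_projData (hK : K ≤ finitePart W) :
    ProjDatum.prodSetRev (projData W q g g' eP' eM' ν K νK) = archSat W K := by
  rw [ProjDatum.prodSetRev_eq_prodSet_of_pairwise _ (pairwise_projData W q g g' eP' eM' ν K hK νK),
    prodSet_projData]

omit [BorelSpace (GA W)] in
/-- **(3) The support of the projected test function**: `tsupport (projTest f) ⊆ T′_∞ K · tsupport f · T′_∞ K`. -/
theorem tsupport_projTest_subset (hgood : ∀ d ∈ projData W q g g' eP' eM' ν K νK, d.Good) (hK : K ≤ finitePart W)
    {f : GA W → ℂ} (hf : HasCompactSupport f) :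
    tsupport (projTest W q g g' eP' eM' ν K νK f) ⊆ archSat W K * tsupport f * archSat W K := by
  haveI : T2Space (GA W) := t2Space_GA W
  have h := tsupport_biProjList_subset (projData W q g g' eP' eM' ν K νK) hgood hf
  rwa [prodSet_projData, prodSetRev_projData W q g g' eP' eM' ν K νK hK] at h

variable (R : RTFData W) (μ : Measure (GA W)) [μ.IsHaarMeasure] [R.μT.IsHaarMeasure] [R.μT'.IsHaarMeasure]
  (DG : Set (GA W)) (fdG : IsFundamentalDomain (rationalPoints W) DG μ) (compG : IsCompact (closure DG))
  (compT : IsCompact (closure R.DT)) (compT' : IsCompact (closure R.DT'))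

/-- **(4) The support of the convolution of the projected pair**:
`tsupport (projTest f ⋆ projTest f′) ⊆ T′_∞K · tsupport f · T′_∞K · tsupport f′ · T′_∞K`. -/
theorem tsupport_conv_projTest_subset (hgood : ∀ d ∈ projData W q g g' eP' eM' ν K νK, d.Good)
    (hK : K ≤ finitePart W) {f f' : GA W → ℂ} (hf : IsTestFn W f) (hf' : IsTestFn W f') :
    tsupport ((Setting.ofAdelicData W R μ DG fdG compG compT compT').conv
        (projTest W q g g' eP' eM' ν K νK f) (projTest W q g g' eP' eM' ν K νK f')) ⊆
      archSat W K * tsupport f * archSat W K * tsupport f' * archSat W K := by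
  haveI : T2Space (GA W) := t2Space_GA W
  have h1 := tsupport_projTest_subset W q g g' eP' eM' ν K νK hgood hK hf.2
  have h2 := tsupport_projTest_subset W q g g' eP' eM' ν K νK hgood hK hf'.2
  have hc1 : HasCompactSupport (projTest W q g g' eP' eM' ν K νK f) :=
    (isTestFn_projTest W q g g' eP' eM' ν K νK hgood hf).2
  have hc2 : HasCompactSupport (projTest W q g g' eP' eM' ν K νK f') :=
    (isTestFn_projTest W q g g' eP' eM' ν K νK hgood hf').2
  calc tsupport ((Setting.ofAdelicData W R μ DG fdG compG compT compT').conv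
          (projTest W q g g' eP' eM' ν K νK f) (projTest W q g g' eP' eM' ν K νK f'))
      ⊆ tsupport (projTest W q g g' eP' eM' ν K νK f) * tsupport (projTest W q g g' eP' eM' ν K νK f') :=
        tsupport_conv_subset _ hc1 hc2
    _ ⊆ (archSat W K * tsupport f * archSat W K) * (archSat W K * tsupport f' * archSat W K) :=
        Set.mul_subset_mul h1 h2
    _ = archSat W K * tsupport f * (archSat W K * archSat W K) * tsupport f' * archSat W K := by
        simp only [mul_assoc]
    _ ⊆ archSat W K * tsupport f * archSat W K * tsupport f' * archSat W K :=
        Set.mul_subset_mul_right (Set.mul_subset_mul_right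
          (Set.mul_subset_mul_left (archSat_mul_archSat_subset W hK)))

/-- **(5) The geometric support of a function supported in the isolated double coset is the single orbit of `γ₀`**:
with `hN` the conclusion of `exists_level_isolating_doubleCoset_archCompact` at level `N` (IsolationArchCompactDC)
and `F` supported in `(Ω · K(N)) · {γ₀} · (Ω · K(N))`, `geoSupport F ⊆ {orbitOf γ₀}`. -/
theorem geoSupport_subset_singleton_of_tsupport_subset (Ω : Set (GA W)) (N : ℕ) (γ₀ : rationalPoints W)
    (hN : ∀ t ∈ closure (Setting.ofAdelicData W R μ DG fdG compG compT compT').DT,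
      ∀ t' ∈ closure (Setting.ofAdelicData W R μ DG fdG compG compT compT').DT',
      ∀ γ : (Setting.ofAdelicData W R μ DG fdG compG compT compT').Gk,
        (t : GA W)⁻¹ * γ * t' ∈
          (Ω * (levelK W N : Set (GA W))) * {(γ₀ : GA W)} * (Ω * (levelK W N : Set (GA W))) →
        (Setting.ofAdelicData W R μ DG fdG compG compT compT').orbitOf γ =
          (Setting.ofAdelicData W R μ DG fdG compG compT compT').orbitOf γ₀)
    {F : GA W → ℂ}
    (hF : tsupport F ⊆ (Ω * (levelK W N : Set (GA W))) * {(γ₀ : GA W)} * (Ω * (levelK W N : Set (GA W)))) :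
    (Setting.ofAdelicData W R μ DG fdG compG compT compT').geoSupport F ⊆
      {(Setting.ofAdelicData W R μ DG fdG compG compT compT').orbitOf γ₀} := by
  rintro o ⟨t, ht, t', ht', γ, hγo, hne⟩
  rw [Set.mem_singleton_iff, ← hγo]
  exact hN t (subset_closure ht) t' (subset_closure ht') γ (hF (subset_tsupport _ hne))

end Projected

end Summit.Ventures.HodgeRepro.Tier4.Line4

end
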